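import Literature.Barriers.NavierStokesRegularity.NavierStokesInequalityProfileKinematics
import Literature.Analysis.FluidPDE.NormalisedPressureDisjointAdd
import Literature.Analysis.FluidPDE.NormalisedPressureCompactSupport
import HarnessLib

/-!
# Scheffer's block from planar profiles, IV: pressure, transport, viscosity — fact D-I discharged

Barrier catalogue support file for `NavierStokesRegularity` (D-0021): the DISCHARGE of fact D-I
`Literature.Barriers.NavierStokesRegularity.NSIBlock_of_profiles` of
`NavierStokesInequalityProfiles` — V. Scheffer, *A solution to the Navier–Stokes inequality with
an internal singularity*, Comm. Math. Phys. 101 (1985), **Lemma 2.1** (pp. 51–55), in the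
smooth-direction form of W. S. Ożański, arXiv:1709.00602v4, **§4.2** ("The proof of the claims
of the proposition", Cases 1 and 2) with the choice **(4.21)** of `ν₀`. Given profile data
`(η, δ, Cᵢ, aᵢ, Qᵢ)` adapted to a geometric arrangement (`IsNSIProfileData`, `IsNSIArrangement`),
the field `u(t) = u¹(t) + u²(t)`, `uⁱ(t) = u[aᵢ(t)vᵢ, Qᵢ(t)]` (`profileField`, Ożański (4.17);
Scheffer (2.10)) is a classical block `IsNSIBlock T ν₀ τ z G u`, `G = R(Ū₁ ∪ Ū₂)`, with
`ν₀ = δ/(2M + 1)`, `M ≥ sup_{[0,T] × ℝ³} |u·Δu|`.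

The kinematic claims (smoothness on the slab, `div u = 0`, `supp u(t) = G`, `|u| = (Q₁+Q₂)∘R⁻¹`,
`∂ₜ|u|² = ∂ₜ(Q₁² + Q₂²)∘R⁻¹`, the gain, `u(0) ≢ 0`) are the tree's
`NavierStokesInequalityProfileSlices`/`…ProfileKinematics`. This file supplies

* the PRESSURE: `normalisedPressure_profileField` — **`p̃[u(t)] = p*[a₁v₁,Q₁] + p*[a₂v₂,Q₂]`**
  (Scheffer (2.14)–(2.15): "the pressure `p` corresponding to `u` is `p¹ + p²`"; Ożański §4.2:
  `p(t) = p*[a₁ᵏv₁,q₁ᵏ] + p*[a₂ᵏv₂,q₂ᵏ]` by Lemma 3.2 (iii) = the tree's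
  `normalisedPressure_add_of_disjoint_of_contDiff`), smooth and axisymmetric, so that the scalar
  `|u(t)|² + 2p̃[u(t)]` is axisymmetric and differentiable with planar trace near a point of `Uᵢ`
  the planar potential `Qᵢ² + 2(p[a₁v₁,Q₁] + p[a₂v₂,Q₂])` (`profilePotential … Qᵢ`;
  Scheffer (2.16)–(2.17));
* the TRANSPORT TERM: `inner_gradient_energyPressure_left/right` — **over `Uᵢ`,
  `u·∇(|u|² + 2p̃)(x,t) = aᵢ(t)vᵢ(q)·∇(Qᵢ² + 2p[a₁v₁,Q₁] + 2p[a₂v₂,Q₂])(q)`, `q = R⁻¹x`**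
  (Scheffer (2.25); Ożański (4.24), (4.35): the pairing of `u[v,f]` with the gradient of an
  axisymmetric scalar is the planar pairing — the tree's `inner_swirlField_gradient`), and
  `inner_gradient_energyPressure_eq_zero` — **off `R(C₁ ∪ C₂)` it vanishes** (Scheffer (2.26);
  Ożański (3.30));
* the VISCOUS TERM: `inner_laplacian_profileField_nonneg` — **`u·Δu ≥ 0` off `R(C₁ ∪ C₂)`**
  (Scheffer (2.19)–(2.22) with (2.8): `u·Δu = qᵢL(qᵢ) ∘ R⁻¹`; Ożański Case 1 with (3.24)), and
  `exists_abs_inner_laplacian_le` — `|u·Δu| ≤ M` on `[0,T] × ℝ³` (continuity on the compact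
  `[0,T] × G`; Scheffer: "`R(C'₁ ∪ C'₂) × [a,b]` is compact … (2.18) holds if `0 < ν < ν₀`";
  Ożański (4.21));
* the ASSEMBLY `isNSIBlock_profileField` by the printed case analysis at `q = R⁻¹x` —
  `q ∈ Cᵢ` (Scheffer (2.18), (2.23), (2.25); Ożański Case 2): `∂ₜ|u|² = ∂ₜ(Qᵢ²) ≤ -δ -
  aᵢvᵢ·∇Φᵢ = -δ - u·∇(|u|² + 2p̃) ≤ -u·∇(|u|² + 2p̃) + 2ν u·Δu` since `2ν|u·Δu| ≤ 2ν₀M ≤ δ`;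
  `q ∉ C₁ ∪ C₂` (Scheffer (2.26)–(2.27); Ożański Case 1): `∂ₜ|u|² ≤ 0 ≤ 2ν u·Δu` and the
  transport term vanishes — and the closed discharge
  **`NSIBlock_of_profiles_holds : NSIBlock_of_profiles`**.

## References

* V. Scheffer, Comm. Math. Phys. 101 (1985), Lemma 2.1 and its proof, (2.10)–(2.27),
  pp. 51–55. [`Scheffer1985`]
* W. S. Ożański, arXiv:1709.00602v4, Lemma 3.2 (iii), §3.4 (3.24)–(3.25), (3.29)–(3.31), §4.2
  (Cases 1–2) with (4.21), (4.24), (4.26), (4.35). [`Ozanski2017NSISingular`]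
-/

noncomputable section

open MeasureTheory Set Function Filter Topology TopologicalSpace WithLp Metric
open scoped ENNReal InnerProductSpace RealInnerProductSpace ContDiff Laplacian

namespace Literature.Barriers.NavierStokesRegularity

open Literature.Analysis.FluidPDE

/-- The field of the block is axisymmetric at every time (sum of two axisymmetric fields
`u[aᵢvᵢ,Qᵢ]`). [cite: Ozanski2017NSISingular, §3.3 (3.10)–(3.12)] -/
theorem isAxisymmetric_profileField (v₁ v₂ : ℝ × ℝ → ℝ × ℝ) (a₁ a₂ : ℝ → ℝ)
    (Q₁ Q₂ : ℝ → ℝ × ℝ → ℝ) (t : ℝ) : IsAxisymmetric (profileField v₁ v₂ a₁ a₂ Q₁ Q₂ t) := by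
  intro θ x
  rw [profileField_apply, profileField_apply, isAxisymmetric_swirlField _ _ θ x,
    isAxisymmetric_swirlField _ _ θ x, ← rotZLIE_apply, ← rotZLIE_apply, ← rotZLIE_apply, map_add]

/-- The pressure function of the field of the block is an axisymmetric scalar (Ożański (3.8)).
[cite: Ozanski2017NSISingular, §3.2 (3.8)] -/
theorem isAxisymmetricScalar_normalisedPressure_profileField (v₁ v₂ : ℝ × ℝ → ℝ × ℝ)
    (a₁ a₂ : ℝ → ℝ) (Q₁ Q₂ : ℝ → ℝ × ℝ → ℝ) (t : ℝ) :
    IsAxisymmetricScalar (normalisedPressure (profileField v₁ v₂ a₁ a₂ Q₁ Q₂ t)) := fun θ x =>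
  normalisedPressure_comp_linearIsometryEquiv_of_equivariant (rotZLIE θ)
    (fun y => isAxisymmetric_profileField v₁ v₂ a₁ a₂ Q₁ Q₂ t θ y) x

namespace IsNSIProfileData

variable {U₁ U₂ : Set (ℝ × ℝ)} {v₁ : ℝ × ℝ → ℝ × ℝ} {f₁ φ₁ : ℝ × ℝ → ℝ} {v₂ : ℝ × ℝ → ℝ × ℝ}
  {f₂ φ₂ : ℝ × ℝ → ℝ} {T τ : ℝ} {z : EuclideanSpace ℝ (Fin 3)} {η δ : ℝ} {C₁ C₂ : Set (ℝ × ℝ)}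
  {a₁ a₂ : ℝ → ℝ} {Q₁ Q₂ : ℝ → ℝ × ℝ → ℝ}

/-! ### The pressure of the block -/

/-- **`p̃[u(t)] = p*[a₁(t)v₁, Q₁(t)] + p*[a₂(t)v₂, Q₂(t)]`** for `t ∈ J` (Scheffer (2.14)–(2.15);
Ożański §4.2 via Lemma 3.2 (iii)).
[cite: Scheffer1985, Lemma 2.1 (2.14)–(2.15)] [cite: Ozanski2017NSISingular, Lemma 3.2 (iii)] -/
theorem normalisedPressure_profileField
    (h : IsNSIProfileData U₁ U₂ v₁ v₂ f₁ f₂ T τ z η δ C₁ C₂ a₁ a₂ Q₁ Q₂)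
    (hA : IsNSIArrangement U₁ U₂ v₁ f₁ φ₁ v₂ f₂ φ₂ T τ z) {t : ℝ} (ht : t ∈ Ioo (-η) (T + η)) :
    normalisedPressure (profileField v₁ v₂ a₁ a₂ Q₁ Q₂ t) =
      normalisedPressure (swirlField (a₁ t • v₁) (Q₁ t)) +
        normalisedPressure (swirlField (a₂ t • v₂) (Q₂ t)) := by
  have h₁ := h.slice₁ hA ht
  have h₂ := h.slice₂ hA ht
  rw [profileField_eq_add]
  exact normalisedPressure_add_of_disjoint_of_contDiff (h.swirlField_eq_zero_or hA ht)
    (contDiff_infty.1 h₁.contDiff_swirlField 1)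
    (lintegral_enorm_sq_lt_top_of_hasCompactSupport h₁.contDiff_swirlField.continuous
      h₁.hasCompactSupport_swirlField)
    (contDiff_infty.1 h₂.contDiff_swirlField 1)
    (lintegral_enorm_sq_lt_top_of_hasCompactSupport h₂.contDiff_swirlField.continuous
      h₂.hasCompactSupport_swirlField)

/-- **The planar trace of the pressure**: `p̃[u(t)](r,0,z) = p[a₁v₁,Q₁](r,z) + p[a₂v₂,Q₂](r,z)`
(Scheffer (2.15): `p(x₁,x₂,0,t) = (p¹ + p²)(x₁,x₂,0,t)`; Ożański (3.20)).
[cite: Scheffer1985, Lemma 2.1 (2.15)] -/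
theorem normalisedPressure_profileField_meridianPoint
    (h : IsNSIProfileData U₁ U₂ v₁ v₂ f₁ f₂ T τ z η δ C₁ C₂ a₁ a₂ Q₁ Q₂)
    (hA : IsNSIArrangement U₁ U₂ v₁ f₁ φ₁ v₂ f₂ φ₂ T τ z) {t : ℝ} (ht : t ∈ Ioo (-η) (T + η))
    (q : ℝ × ℝ) :
    normalisedPressure (profileField v₁ v₂ a₁ a₂ Q₁ Q₂ t) (meridianPoint q) =
      planePressure (a₁ t • v₁) (Q₁ t) q + planePressure (a₂ t • v₂) (Q₂ t) q := by
  rw [h.normalisedPressure_profileField hA ht]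
  rfl

/-- `p̃[u(t)] ∈ C^∞` for `t ∈ J` (Ożański (3.21); the tree's
`contDiff_normalisedPressure_of_contDiff_infty`). [cite: Ozanski2017NSISingular, §3.3 (3.21)] -/
theorem contDiff_normalisedPressure_profileField
    (h : IsNSIProfileData U₁ U₂ v₁ v₂ f₁ f₂ T τ z η δ C₁ C₂ a₁ a₂ Q₁ Q₂)
    (hA : IsNSIArrangement U₁ U₂ v₁ f₁ φ₁ v₂ f₂ φ₂ T τ z) {t : ℝ} (ht : t ∈ Ioo (-η) (T + η)) :
    ContDiff ℝ ∞ (normalisedPressure (profileField v₁ v₂ a₁ a₂ Q₁ Q₂ t)) :=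
  contDiff_normalisedPressure_of_contDiff_infty (h.contDiff_profileField hA ht)
    (h.hasCompactSupport_profileField hA ht)

/-! ### The scalar `|u|² + 2p̃[u]` -/

/-- The scalar `|u(t)|² + 2p̃[u(t)]` is axisymmetric. [cite: Ozanski2017NSISingular, §3.2 (3.8)] -/
theorem isAxisymmetricScalar_energyPressure
    (h : IsNSIProfileData U₁ U₂ v₁ v₂ f₁ f₂ T τ z η δ C₁ C₂ a₁ a₂ Q₁ Q₂)
    (hA : IsNSIArrangement U₁ U₂ v₁ f₁ φ₁ v₂ f₂ φ₂ T τ z) {t : ℝ} (ht : t ∈ Ioo (-η) (T + η)) :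
    IsAxisymmetricScalar fun y => ‖profileField v₁ v₂ a₁ a₂ Q₁ Q₂ t y‖ ^ 2 +
      2 * normalisedPressure (profileField v₁ v₂ a₁ a₂ Q₁ Q₂ t) y := by
  intro θ y
  have hp := isAxisymmetricScalar_normalisedPressure_profileField v₁ v₂ a₁ a₂ Q₁ Q₂ t θ y
  simp only
  rw [h.norm_sq_profileField hA ht, h.norm_sq_profileField hA ht, meridian_rotZ, hp]

/-- The scalar `|u(t)|² + 2p̃[u(t)]` is differentiable (indeed `C²`). [folklore] -/
theorem differentiable_energyPressure
    (h : IsNSIProfileData U₁ U₂ v₁ v₂ f₁ f₂ T τ z η δ C₁ C₂ a₁ a₂ Q₁ Q₂)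
    (hA : IsNSIArrangement U₁ U₂ v₁ f₁ φ₁ v₂ f₂ φ₂ T τ z) {t : ℝ} (ht : t ∈ Ioo (-η) (T + η)) :
    Differentiable ℝ fun y => ‖profileField v₁ v₂ a₁ a₂ Q₁ Q₂ t y‖ ^ 2 +
      2 * normalisedPressure (profileField v₁ v₂ a₁ a₂ Q₁ Q₂ t) y :=
  (((h.contDiff_profileField hA ht).differentiable (by simp)).norm_sq ℝ).add
    (((h.contDiff_normalisedPressure_profileField hA ht).differentiable (by simp)).const_mul 2)

/-- **The planar trace of `|u|² + 2p̃[u]` near a point of `U₁`** is the planar potential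
`Q₁² + 2(p[a₁v₁,Q₁] + p[a₂v₂,Q₂])` (`Q₂ = 0` near `U₁`; Scheffer (2.16)–(2.17), (2.23)).
[cite: Scheffer1985, Lemma 2.1 (2.16)–(2.17) and (2.23)] -/
theorem energyPressure_meridianPoint_eventuallyEq_left
    (h : IsNSIProfileData U₁ U₂ v₁ v₂ f₁ f₂ T τ z η δ C₁ C₂ a₁ a₂ Q₁ Q₂)
    (hA : IsNSIArrangement U₁ U₂ v₁ f₁ φ₁ v₂ f₂ φ₂ T τ z) {t : ℝ} (ht : t ∈ Ioo (-η) (T + η))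
    {q : ℝ × ℝ} (hq : q ∈ U₁) :
    (fun q' => ‖profileField v₁ v₂ a₁ a₂ Q₁ Q₂ t (meridianPoint q')‖ ^ 2 +
        2 * normalisedPressure (profileField v₁ v₂ a₁ a₂ Q₁ Q₂ t) (meridianPoint q')) =ᶠ[𝓝 q]
      profilePotential v₁ v₂ a₁ a₂ Q₁ Q₂ Q₁ t := by
  have hq1 : 0 < q.1 := hA.structure₁.subset_halfPlane hq
  have hq2 : q ∉ closure U₂ := Set.disjoint_left.1 hA.disjoint (subset_closure hq)
  filter_upwards [(isOpen_lt continuous_const continuous_fst).mem_nhds hq1,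
    isClosed_closure.isOpen_compl.mem_nhds hq2] with q' hq' hq'2
  rw [h.norm_sq_profileField hA ht, h.normalisedPressure_profileField_meridianPoint hA ht,
    meridian_meridianPoint (le_of_lt hq'), h.Q₂_eq_zero t ht q' hq'2, profilePotential]
  ring

/-- **The planar trace of `|u|² + 2p̃[u]` near a point of `U₂`** is
`Q₂² + 2(p[a₁v₁,Q₁] + p[a₂v₂,Q₂])`. [cite: Scheffer1985, Lemma 2.1 (2.16)–(2.17) and (2.23)] -/
theorem energyPressure_meridianPoint_eventuallyEq_right
    (h : IsNSIProfileData U₁ U₂ v₁ v₂ f₁ f₂ T τ z η δ C₁ C₂ a₁ a₂ Q₁ Q₂)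
    (hA : IsNSIArrangement U₁ U₂ v₁ f₁ φ₁ v₂ f₂ φ₂ T τ z) {t : ℝ} (ht : t ∈ Ioo (-η) (T + η))
    {q : ℝ × ℝ} (hq : q ∈ U₂) :
    (fun q' => ‖profileField v₁ v₂ a₁ a₂ Q₁ Q₂ t (meridianPoint q')‖ ^ 2 +
        2 * normalisedPressure (profileField v₁ v₂ a₁ a₂ Q₁ Q₂ t) (meridianPoint q')) =ᶠ[𝓝 q]
      profilePotential v₁ v₂ a₁ a₂ Q₁ Q₂ Q₂ t := by
  have hq1 : 0 < q.1 := hA.structure₂.subset_halfPlane hq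
  have hq2 : q ∉ closure U₁ := Set.disjoint_right.1 hA.disjoint (subset_closure hq)
  filter_upwards [(isOpen_lt continuous_const continuous_fst).mem_nhds hq1,
    isClosed_closure.isOpen_compl.mem_nhds hq2] with q' hq' hq'2
  rw [h.norm_sq_profileField hA ht, h.normalisedPressure_profileField_meridianPoint hA ht,
    meridian_meridianPoint (le_of_lt hq'), h.Q₁_eq_zero t ht q' hq'2, profilePotential]
  ring

/-! ### The transport term -/

/-- **The transport term over `U₁`** (Scheffer (2.25); Ożański §4.2, Case 2 with (4.24), (4.35)):
for `t ∈ J` and `R⁻¹x = q ∈ U₁`,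
`u·∇(|u|² + 2p̃[u])(x,t) = a₁(t)v₁(q)·∇(Q₁(t)² + 2p[a₁v₁,Q₁] + 2p[a₂v₂,Q₂])(q)`.
[cite: Scheffer1985, Lemma 2.1 (2.25)] [cite: Ozanski2017NSISingular, §4.2 (4.24) and (4.35)] -/
theorem inner_gradient_energyPressure_left
    (h : IsNSIProfileData U₁ U₂ v₁ v₂ f₁ f₂ T τ z η δ C₁ C₂ a₁ a₂ Q₁ Q₂)
    (hA : IsNSIArrangement U₁ U₂ v₁ f₁ φ₁ v₂ f₂ φ₂ T τ z) {t : ℝ} (ht : t ∈ Ioo (-η) (T + η))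
    {x : EuclideanSpace ℝ (Fin 3)} (hx : meridian x ∈ U₁) :
    ⟪profileField v₁ v₂ a₁ a₂ Q₁ Q₂ t x,
        gradient (fun y => ‖profileField v₁ v₂ a₁ a₂ Q₁ Q₂ t y‖ ^ 2 +
          2 * normalisedPressure (profileField v₁ v₂ a₁ a₂ Q₁ Q₂ t) y) x⟫ =
      a₁ t * (v₁ (meridian x)).1 * derivR (profilePotential v₁ v₂ a₁ a₂ Q₁ Q₂ Q₁ t) (meridian x) +
        a₁ t * (v₁ (meridian x)).2 *
          derivZ (profilePotential v₁ v₂ a₁ a₂ Q₁ Q₂ Q₁ t) (meridian x) := by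
  have hq1 : 0 < (meridian x).1 := hA.structure₁.subset_halfPlane hx
  have hxr : cylRadius x ≠ 0 := hq1.ne'
  have hx2 : meridian x ∉ closure U₂ := Set.disjoint_left.1 hA.disjoint (subset_closure hx)
  have hloc := h.energyPressure_meridianPoint_eventuallyEq_left hA ht hx
  rw [h.profileField_eq_left hA ht hx2,
    inner_swirlField_gradient (h.isAxisymmetricScalar_energyPressure hA ht) _ _ hxr
      (h.differentiable_energyPressure hA ht x), derivR, derivZ, hloc.fderiv_eq]
  simp only [Pi.smul_apply, Prod.smul_fst, Prod.smul_snd, smul_eq_mul, derivR, derivZ, mul_assoc]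

/-- **The transport term over `U₂`**: for `t ∈ J` and `R⁻¹x = q ∈ U₂`,
`u·∇(|u|² + 2p̃[u])(x,t) = a₂(t)v₂(q)·∇(Q₂(t)² + 2p[a₁v₁,Q₁] + 2p[a₂v₂,Q₂])(q)`.
[cite: Scheffer1985, Lemma 2.1 (2.25)] [cite: Ozanski2017NSISingular, §4.2 (4.24) and (4.35)] -/
theorem inner_gradient_energyPressure_right
    (h : IsNSIProfileData U₁ U₂ v₁ v₂ f₁ f₂ T τ z η δ C₁ C₂ a₁ a₂ Q₁ Q₂)
    (hA : IsNSIArrangement U₁ U₂ v₁ f₁ φ₁ v₂ f₂ φ₂ T τ z) {t : ℝ} (ht : t ∈ Ioo (-η) (T + η))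
    {x : EuclideanSpace ℝ (Fin 3)} (hx : meridian x ∈ U₂) :
    ⟪profileField v₁ v₂ a₁ a₂ Q₁ Q₂ t x,
        gradient (fun y => ‖profileField v₁ v₂ a₁ a₂ Q₁ Q₂ t y‖ ^ 2 +
          2 * normalisedPressure (profileField v₁ v₂ a₁ a₂ Q₁ Q₂ t) y) x⟫ =
      a₂ t * (v₂ (meridian x)).1 * derivR (profilePotential v₁ v₂ a₁ a₂ Q₁ Q₂ Q₂ t) (meridian x) +
        a₂ t * (v₂ (meridian x)).2 *
          derivZ (profilePotential v₁ v₂ a₁ a₂ Q₁ Q₂ Q₂ t) (meridian x) := by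
  have hq1 : 0 < (meridian x).1 := hA.structure₂.subset_halfPlane hx
  have hxr : cylRadius x ≠ 0 := hq1.ne'
  have hx1 : meridian x ∉ closure U₁ := Set.disjoint_right.1 hA.disjoint (subset_closure hx)
  have hloc := h.energyPressure_meridianPoint_eventuallyEq_right hA ht hx
  rw [h.profileField_eq_right hA ht hx1,
    inner_swirlField_gradient (h.isAxisymmetricScalar_energyPressure hA ht) _ _ hxr
      (h.differentiable_energyPressure hA ht x), derivR, derivZ, hloc.fderiv_eq]
  simp only [Pi.smul_apply, Prod.smul_fst, Prod.smul_snd, smul_eq_mul, derivR, derivZ, mul_assoc]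

/-- **The transport term vanishes off `R(C₁ ∪ C₂)`** (Scheffer (2.26); Ożański (3.30)): for
`t ∈ J` and `R⁻¹x ∉ C₁ ∪ C₂` (so `v₁(R⁻¹x) = v₂(R⁻¹x) = 0`), `u·∇(|u|² + 2p̃[u])(x,t) = 0`.
[cite: Scheffer1985, Lemma 2.1 (2.26)] [cite: Ozanski2017NSISingular, §3.4 (3.30)] -/
theorem inner_gradient_energyPressure_eq_zero
    (h : IsNSIProfileData U₁ U₂ v₁ v₂ f₁ f₂ T τ z η δ C₁ C₂ a₁ a₂ Q₁ Q₂)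
    (hA : IsNSIArrangement U₁ U₂ v₁ f₁ φ₁ v₂ f₂ φ₂ T τ z) {t : ℝ} (ht : t ∈ Ioo (-η) (T + η))
    {x : EuclideanSpace ℝ (Fin 3)} (hx : meridian x ∉ C₁ ∪ C₂) :
    ⟪profileField v₁ v₂ a₁ a₂ Q₁ Q₂ t x,
        gradient (fun y => ‖profileField v₁ v₂ a₁ a₂ Q₁ Q₂ t y‖ ^ 2 +
          2 * normalisedPressure (profileField v₁ v₂ a₁ a₂ Q₁ Q₂ t) y) x⟫ = 0 := by
  rw [mem_union, not_or] at hx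
  have hv₁ : (a₁ t • v₁) (meridian x) = 0 := by
    rw [Pi.smul_apply, image_eq_zero_of_notMem_tsupport fun h' => hx.1 (h.tsupport_v₁ h'),
      smul_zero]
  have hv₂ : (a₂ t • v₂) (meridian x) = 0 := by
    rw [Pi.smul_apply, image_eq_zero_of_notMem_tsupport fun h' => hx.2 (h.tsupport_v₂ h'),
      smul_zero]
  have hax := h.isAxisymmetricScalar_energyPressure hA ht
  rw [profileField_apply, inner_add_left, inner_swirlField_gradient_eq_zero hax _ _ hv₁,
    inner_swirlField_gradient_eq_zero hax _ _ hv₂, add_zero]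

/-! ### The viscous term -/

/-- **`u·Δu ≥ 0` off `R(C₁ ∪ C₂)`** for `t ∈ [0,T]` (Scheffer (2.19)–(2.22) with (2.8): there
`u = uⁱ = u[0, qᵢ,ₜ]` near `x` and `⟨u, Δu⟩ = qᵢ,ₜ L(qᵢ,ₜ) ∘ R⁻¹ ≥ 0`, or `u = 0` near `x`;
Ożański §4.2, Case 1 with (3.24)). [cite: Scheffer1985, Lemma 2.1 (2.19)–(2.22)] -/
theorem inner_laplacian_profileField_nonneg
    (h : IsNSIProfileData U₁ U₂ v₁ v₂ f₁ f₂ T τ z η δ C₁ C₂ a₁ a₂ Q₁ Q₂)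
    (hA : IsNSIArrangement U₁ U₂ v₁ f₁ φ₁ v₂ f₂ φ₂ T τ z) {t : ℝ} (ht : t ∈ Icc (0 : ℝ) T)
    {x : EuclideanSpace ℝ (Fin 3)} (hx : meridian x ∉ C₁ ∪ C₂) :
    0 ≤ ⟪profileField v₁ v₂ a₁ a₂ Q₁ Q₂ t x, (Δ (profileField v₁ v₂ a₁ a₂ Q₁ Q₂ t)) x⟫ := by
  have htJ := h.Icc_subset ht
  rw [mem_union, not_or] at hx
  by_cases h1 : meridian x ∈ closure U₁
  · have hx2 : meridian x ∉ closure U₂ := Set.disjoint_left.1 hA.disjoint h1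
    have hloc := h.profileField_eventuallyEq_left hA htJ hx2
    have hr : cylRadius x ≠ 0 := ne_of_gt (hA.structure₁.closure_subset h1)
    have hq : meridian x ∉ tsupport (a₁ t • v₁) := fun h' =>
      hx.1 (h.tsupport_v₁ (tsupport_smul_subset_right (fun _ => a₁ t) v₁ h'))
    rw [(InnerProductSpace.laplacian_congr_nhds hloc).self_of_nhds, hloc.self_of_nhds,
      (h.slice₁ hA htJ).inner_swirlField_laplacian_eq hr hq]
    exact h.opL₁ t ht _ hx.1 (hA.structure₁.closure_subset h1)
  · by_cases h2 : meridian x ∈ closure U₂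
    · have hloc := h.profileField_eventuallyEq_right hA htJ h1
      have hr : cylRadius x ≠ 0 := ne_of_gt (hA.structure₂.closure_subset h2)
      have hq : meridian x ∉ tsupport (a₂ t • v₂) := fun h' =>
        hx.2 (h.tsupport_v₂ (tsupport_smul_subset_right (fun _ => a₂ t) v₂ h'))
      rw [(InnerProductSpace.laplacian_congr_nhds hloc).self_of_nhds, hloc.self_of_nhds,
        (h.slice₂ hA htJ).inner_swirlField_laplacian_eq hr hq]
      exact h.opL₂ t ht _ hx.2 (hA.structure₂.closure_subset h2)
    · rw [h.profileField_eq_zero hA htJ (fun h' => h'.elim h1 h2), inner_zero_left]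

/-- **`u·Δu` is bounded on `[0,T] × ℝ³`**: `|⟨u, Δu⟩(x,t)| ≤ M` (continuity of `u` and `Δu` on
the slab, from the joint smoothness, and compactness of `[0,T] × G`; off `G`, `u = 0`). This is
the finiteness behind Scheffer's "`ν₀ > 0` such that (2.18) holds if `0 < ν < ν₀`" and Ożański's
(4.21). [cite: Scheffer1985, Lemma 2.1 (2.18)] [cite: Ozanski2017NSISingular, §4.1 (4.21)] -/
theorem exists_abs_inner_laplacian_le
    (h : IsNSIProfileData U₁ U₂ v₁ v₂ f₁ f₂ T τ z η δ C₁ C₂ a₁ a₂ Q₁ Q₂)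
    (hA : IsNSIArrangement U₁ U₂ v₁ f₁ φ₁ v₂ f₂ φ₂ T τ z) :
    ∃ M : ℝ, 0 ≤ M ∧ ∀ t ∈ Icc (0 : ℝ) T, ∀ x : EuclideanSpace ℝ (Fin 3),
      |⟪profileField v₁ v₂ a₁ a₂ Q₁ Q₂ t x, (Δ (profileField v₁ v₂ a₁ a₂ Q₁ Q₂ t)) x⟫| ≤ M := by
  have hS := h.isSmoothSpaceTimeOn_profileField hA
  have hL := hS.laplacian isOpen_Ioo.uniqueDiffOn
  have hc : ContinuousOn (fun p : ℝ × EuclideanSpace ℝ (Fin 3) =>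
      ⟪profileField v₁ v₂ a₁ a₂ Q₁ Q₂ p.1 p.2, (Δ (profileField v₁ v₂ a₁ a₂ Q₁ Q₂ p.1)) p.2⟫)
      (Ioo (-η) (T + η) ×ˢ univ) :=
    hS.continuousOn.inner hL.continuousOn
  have hK : IsCompact (Icc (0 : ℝ) T ×ˢ revolve (closure U₁ ∪ closure U₂)) :=
    isCompact_Icc.prod hA.isCompact_revolve
  obtain ⟨M, hM⟩ := hK.exists_bound_of_continuousOn
    (hc.mono (prod_mono h.Icc_subset (subset_univ _)))
  refine ⟨max M 0, le_max_right _ _, fun t ht x => ?_⟩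
  by_cases hx : x ∈ revolve (closure U₁ ∪ closure U₂)
  · have := hM (t, x) ⟨ht, hx⟩
    rw [Real.norm_eq_abs] at this
    exact this.trans (le_max_left _ _)
  · rw [h.profileField_eq_zero hA (h.Icc_subset ht) (by simpa using hx), inner_zero_left, abs_zero]
    exact le_max_right _ _

/-! ### The block -/

/-- **Scheffer's Lemma 2.1 / Ożański's Proposition 4.2 for given profiles.** For profile data
adapted to a geometric arrangement, `u(t) = u[a₁(t)v₁, Q₁(t)] + u[a₂(t)v₂, Q₂(t)]` is a classical
block `IsNSIBlock T ν₀ τ z G u`, `G = R(Ū₁ ∪ Ū₂)`, with `ν₀ = δ/(2M + 1)`,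
`M ≥ sup |u·Δu|` on `[0,T] × ℝ³`. The Navier–Stokes inequality at `(x,t)`, `q = R⁻¹x`: for
`q ∈ Cᵢ`, `∂ₜ|u|² = ∂ₜ(Qᵢ²) ≤ -δ - aᵢvᵢ·∇(Qᵢ² + 2p + 2p) = -δ - u·∇(|u|² + 2p̃) ≤ -u·∇(|u|² + 2p̃)
+ 2ν u·Δu` as `2ν|u·Δu| ≤ δ`; for `q ∉ C₁ ∪ C₂`, `∂ₜ|u|² ≤ 0`, `u·∇(|u|² + 2p̃) = 0` and
`u·Δu ≥ 0`. [cite: Scheffer1985, Lemma 2.1] [cite: Ozanski2017NSISingular, §4.2 and (4.21)] -/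
theorem isNSIBlock_profileField
    (h : IsNSIProfileData U₁ U₂ v₁ v₂ f₁ f₂ T τ z η δ C₁ C₂ a₁ a₂ Q₁ Q₂)
    (hA : IsNSIArrangement U₁ U₂ v₁ f₁ φ₁ v₂ f₂ φ₂ T τ z) :
    ∃ ν₀ : ℝ, IsNSIBlock T ν₀ τ z (revolve (closure U₁ ∪ closure U₂))
      (profileField v₁ v₂ a₁ a₂ Q₁ Q₂) := by
  obtain ⟨M, hM0, hM⟩ := h.exists_abs_inner_laplacian_le hA
  have hν₀ : 0 < δ / (2 * M + 1) := div_pos h.δ_pos (by linarith)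
  refine ⟨δ / (2 * M + 1), ?_⟩
  exact
    { T_pos := hA.T_pos
      ν₀_pos := hν₀
      τ_pos := hA.τ_mem.1
      τ_lt_one := hA.τ_mem.2
      isCompact := hA.isCompact_revolve
      smooth := ⟨η, h.η_pos, h.isSmoothSpaceTimeOn_profileField hA⟩
      divFree := fun t ht => h.isDivFree_profileField hA (h.Icc_subset ht)
      tsupport_eq := fun t ht => h.tsupport_profileField hA (h.Icc_subset ht)
      nsi := by
        intro ν hν t ht x
        have htJ := h.Icc_subset ht
        set L := ⟪profileField v₁ v₂ a₁ a₂ Q₁ Q₂ t x,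
          (Δ (profileField v₁ v₂ a₁ a₂ Q₁ Q₂ t)) x⟫ with hLdef
        -- the slack absorbs the viscous term: `2ν|u·Δu| ≤ δ`
        have hvisc : -δ ≤ 2 * ν * L := by
          have h1 : ν * |L| ≤ δ / (2 * M + 1) * M :=
            mul_le_mul hν.2 (hM t ht x) (abs_nonneg _) hν₀.le
          have h2 : δ / (2 * M + 1) * M * 2 ≤ δ := by
            rw [div_mul_eq_mul_div, div_mul_eq_mul_div, div_le_iff₀ (by linarith)]
            nlinarith [h.δ_pos]
          have h3 : ν * -|L| ≤ ν * L := mul_le_mul_of_nonneg_left (neg_abs_le L) hν.1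
          nlinarith
        rw [h.timeDeriv_norm_sq_profileField hA htJ x]
        by_cases hq₁ : meridian x ∈ C₁
        · -- Case 2 over `U₁`
          have hU : meridian x ∈ U₁ := h.subset₁ hq₁
          have hx2 : meridian x ∉ closure U₂ :=
            Set.disjoint_left.1 hA.disjoint (subset_closure hU)
          rw [h.deriv_Q₂_sq_eq_zero htJ hx2, add_zero,
            h.inner_gradient_energyPressure_left hA htJ hU]
          have hin := h.inner₁ t ht _ hq₁
          linarith
        · by_cases hq₂ : meridian x ∈ C₂
          · -- Case 2 over `U₂`
            have hU : meridian x ∈ U₂ := h.subset₂ hq₂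
            have hx1 : meridian x ∉ closure U₁ :=
              Set.disjoint_right.1 hA.disjoint (subset_closure hU)
            rw [h.deriv_Q₁_sq_eq_zero htJ hx1, zero_add,
              h.inner_gradient_energyPressure_right hA htJ hU]
            have hin := h.inner₂ t ht _ hq₂
            linarith
          · -- Case 1: off `R(C₁ ∪ C₂)`
            have hx' : meridian x ∉ C₁ ∪ C₂ := fun h' => h'.elim hq₁ hq₂
            rw [h.inner_gradient_energyPressure_eq_zero hA htJ hx', neg_zero, zero_add]
            have h1 := h.outer₁ t ht _ hq₁
            have h2 := h.outer₂ t ht _ hq₂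
            have h3 : 0 ≤ L := h.inner_laplacian_profileField_nonneg hA ht hx'
            have h4 : 0 ≤ 2 * ν * L := mul_nonneg (mul_nonneg two_pos.le hν.1) h3
            linarith
      mapsTo := hA.mapsTo
      gain := h.gain_profileField hA
      nontrivial := h.exists_profileField_zero_ne_zero hA }

end IsNSIProfileData

/-- **Fact D-I discharged — Scheffer 1985, Lemma 2.1** (in the smooth-direction form of Ożański
2017, §4.2 with (4.21)): for a geometric arrangement and profile data adapted to it, the field
`u(t) = u[a₁(t)v₁, Q₁(t)] + u[a₂(t)v₂, Q₂(t)]` is a classical block for some `ν₀ > 0`.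
[cite: Scheffer1985, Lemma 2.1] [cite: Ozanski2017NSISingular, §4.2 and (4.21)] -/
theorem NSIBlock_of_profiles_holds : NSIBlock_of_profiles :=
  fun _ _ _ _ _ _ _ _ _ _ _ _ _ _ _ _ _ _ _ hA h => h.isNSIBlock_profileField hA

end Literature.Barriers.NavierStokesRegularity
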